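import Summits.BirchSwinnertonDyer.BirchSwinnertonDyer.Theorems.KolyvaginDepthDoorDepthTableSteinWuthrichRankThree11642a1
import Summits.BirchSwinnertonDyer.BirchSwinnertonDyer.Theorems.Rank2Observatory11642a1TwoDescRankThree
import Summits.BirchSwinnertonDyer.BirchSwinnertonDyer.Theorems.KolyvaginDepthDoorDepthTableSteinWuthrichRankThree11642a1TwistLValue
import HarnessLib

/-!
# Route `KolyvaginDepthDoor`, crux `KolyvaginDepthSupplyKN` (stmt-BirchSwinnertonDyer-22820) —
# DEPTH TABLE v14: the odd-rank row `11642a1` with the RANK DISCHARGED (`rank E(ℚ) = 3` by the tree's kernel 2-descent)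
# — «the depth-TWO bit ⟺ `#Sel_5(E^{(−7)}/ℚ) ≤ 25`», exactly

Helper file of the lead prover of line `levelone` (kdd-p1 g18; `--supports stmt-BirchSwinnertonDyer-22820
--as helper`); it closes nothing and BSD is NOT proved by it.

Sequel of `KolyvaginDepthDoorDepthTableSteinWuthrichRankThree11642a1` (certs, `Ш(E)[5] = 0` by name, the exact rows with
`rank E` symbolic, the crux's clause modulo ONE twist bound). Of the nine rank-3 curves of v14, `11642a1` is the one whose
Mordell–Weil rank the tree holds EXACTLY: `Rank2Observatory.C11642a1.mordellWeilRank_eq_three` (Cassels' `x − θ` 2-descent over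
the cubic field, `decide` only; lower bound `Rank3KernelCerts001`). Transported to the atlas curve (`mordellWeilRank_eq_three`),
it turns the symbolic rows into the honest depth-TWO row of the instrument:

* `exactRowDepthTwo_5_neg7_iff_twistSelmer` — for ANY imaginary quadratic `K` with `d_K = −7`: «∃ frame, square-free `n₁` with
  EXACTLY TWO Kolyvagin prime factors, datum: `c_1(n₁) ≠ 0`» `↔` «`#Sel_5(E^{(−7)}/ℚ) ≤ 25`» — the bit a depth-2
  Jetchev–Lauter–Stein computation at `p = 5` would return IS «`dim_𝔽₅ Sel_5(E^{(−7)}) ≤ 2`»; the twist has even analytic rank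
  and numerically `L(E^{(−7)},1) ≈ 7.22 ≠ 0` (context only), so for the rank-zero twist this is «`#Ш(E^{(−7)}/ℚ)[5] ≤ 25`».
* `exactBody_5_neg7_iff_twistCondition_rankThree` — the crux's `∃`-body at `(E, 5, K)` `↔`
  «`#Sel_5(E^{(−7)}) ≤ 125` ∨ (`Ш(E^{(−7)})[5] = 0` ∧ `rank E^{(−7)} = 4`)».

* `exists_kolyvaginClass_depthTwo_ne_zero_of_LValue` — **the instrument's PREDICTION from one `L`-value**: with
  `…RankThree11642a1TwistLValue` (Skinner 2016 Thm. C + GZK: `L(T,1) ≠ 0 ∧ ord_5(L(T,1)/Ω_T) ≤ 0 ⟹ #Sel_5(E^{(−7)}) = 1`),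
  the depth-two row yields a NON-ZERO level-one Kolyvagin class `c_1(ℓ₁ℓ₂) mod 5` on some pair of Kolyvagin primes —
  falsifiable by a depth-2 Jetchev–Lauter–Stein computation, derived with no Kolyvagin-class computation at all.

CONDITIONAL on (γ) = Gross 1991 Prop. 3.7 (2), W. Zhang 2014 Lemma 8.4 (1) / Thm. 9.1, Stein–Wuthrich 2013 Thm. 1.1 and (last
theorem) Skinner 2016 Thm. C + Gross–Zagier–Kolyvagin, BY NAME; per curve; nothing class-wide (the open stub (S♭) is untouched);
BSD is NOT proved by any of this.

References: [SteinWuthrich2013] Thm. 1.1 (p. 1758); [WZhang2014] Lemma 8.4 (1) (p. 236), Thm. 9.1 (p. 240); [GrossLMS1991]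
Prop. 3.7 (2); [CremonaAlgorithms1997] §3.5, Table 1 (11642a1); [JetchevLauterStein2009] §3.6.
-/

set_option linter.dupNamespace false

noncomputable section

open scoped Classical NumberField

namespace Summit.BirchSwinnertonDyer.BirchSwinnertonDyer.Theorems.KolyvaginDepthDoor

open Literature.NumberTheory.EllipticCurves Literature.NumberTheory.EllipticCurves.ModularForms
  WeierstrassCurve NumberField IsDedekindDomain
open Summit.BirchSwinnertonDyer.BirchSwinnertonDyer.Theorems
open Summit.BirchSwinnertonDyer.BirchSwinnertonDyer.Rank2Observatory
open Summit.BirchSwinnertonDyer.BirchSwinnertonDyer.Rank1Residual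
open Summit.BirchSwinnertonDyer.Rank1Residual.Additive

namespace C11642a1

/-- **`rank_ℤ E(ℚ) = 3` for the atlas curve `11642a1`** — the tree's kernel 2-descent
`Rank2Observatory.C11642a1.mordellWeilRank_eq_three` (upper bound `≤ 3` by Cassels' map over the cubic field; lower bound
`Rank3KernelCerts001`), transported along `c11642a1.e ⊗ ℚ = [1,−1,0,−16,28] ⊗ ℚ` (`intModel`).
[cite: CremonaAlgorithms1997, §3.5, Table 1 (11642a1)] -/
theorem mordellWeilRank_eq_three :
    haveI := isElliptic_of_mem_atlasR3A00 mem_atlas;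
    (c11642a1.e.baseChange ℚ).mordellWeilRank = 3 := by
  haveI := isElliptic_of_mem_atlasR3A00 mem_atlas
  haveI := isGloballyMinimal_of_mem_atlasR3A00 mem_atlas
  have h : c11642a1.e.baseChange ℚ = (⟨1, -1, 0, -16, 28⟩ : WeierstrassCurve ℤ).baseChange ℚ :=
    eq_baseChange_of_intModel intModel
  have h' : (⟨1, -1, 0, -16, 28⟩ : WeierstrassCurve ℤ).baseChange ℚ =
      (⟨1, -1, 0, -16, 28⟩ : WeierstrassCurve ℤ).map (Int.castRingHom ℚ) := by
    rw [WeierstrassCurve.baseChange, algebraMap_int_eq]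
  rw [h, h']
  exact Rank2Observatory.C11642a1.mordellWeilRank_eq_three

/-- **DEPTH-TABLE ROW `11642a1`, `(p, d_K) = (5, −7)`, at depth TWO, rank discharged — «ONE BIT ⟺ ONE TWIST-SELMER BOUND».**
For `E = 11642a1` (`rank E(ℚ) = 3` in the kernel) and ANY imaginary quadratic `K` with `d_K = −7`: «∃ frame, square-free
product `n₁` of EXACTLY TWO Kolyvagin primes, datum: `c_1(n₁) ≠ 0`» `↔` «`#Sel_5(E^{(−7)}/ℚ) ≤ 25`». From the symbolic row
`exactRowDepth_5_neg7_iff_twistSelmer` with `rank E = 3` (`mordellWeilRank_eq_three`). The twist `E^{(−7)}` has EVEN analytic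
rank; where it is `0` (numerically `L(E^{(−7)},1) ≈ 7.22`) the bit is «`#Ш(E^{(−7)}/ℚ)[5] ≤ 25`», i.e. `dim Ш[5] ≤ 2`.
CONDITIONAL on (γ), W. Zhang L8.4 (1) / 9.1 and SW Thm. 1.1 by name; per curve; BSD is not proved by it.
[cite: SteinWuthrich2013, Thm. 1.1 (p. 1758)] [cite: WZhang2014, Lemma 8.4 (1) (p. 236)] [cite: GrossLMS1991, Prop. 3.7 (2), §5 (5.1)]
[cite: JetchevLauterStein2009, §3.6 (arXiv:0707.0032)] -/
theorem exactRowDepthTwo_5_neg7_iff_twistSelmer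
    (hSW : SteinWuthrich2013_sha_inf_torsionBy_eq_bot_of_two_le_rank)
    (h372 : GrossLMS1991.prop37_2_frobeniusCongruence)
    (h84 : Literature.NumberTheory.EllipticCurves.WZhang2014_lemma84_exists_minimal_kolyvaginClass_one_selmerCard)
    (K : Type) [Field K] [NumberField K] (hK : IsImaginaryQuadratic K)
    (hD : NumberField.discr K = -7) :
    haveI := isElliptic_of_mem_atlasR3A00 mem_atlas;
    haveI := isGloballyMinimal_of_mem_atlasR3A00 mem_atlas;
    haveI : NeZero ((c11642a1.e.baseChange ℚ).conductorNorm ℤ) := neZero_conductorNorm_of_isElliptic _;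
    haveI := Fact.mk (by norm_num : Nat.Prime 5);
    (∃ (Dt : ModularParametrizationData (c11642a1.e.baseChange ℚ) ((c11642a1.e.baseChange ℚ).conductorNorm ℤ)) (β : ℤ) (ι : K →+* ℂ) (n₁ : ℕ)
      (d : KolyvaginHeegnerData Dt β ι n₁), Squarefree n₁ ∧
        (∀ q ∈ n₁.primeFactors, Zhang2014.IsKolyvaginPrime ((c11642a1.e.baseChange ℚ).conductorNorm ℤ) (c11642a1.e.baseChange ℚ) K 5 q) ∧
        n₁.primeFactors.card = 2 ∧ d.kolyvaginClass (p := 5) (by norm_num) 1 ≠ 0) ↔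
    Nat.card (((c11642a1.e.baseChange ℚ).quadraticTwist (NumberField.discr K : ℚ)).selmerGroup (5 : ℕ)) ≤ 25 := by
  haveI := isElliptic_of_mem_atlasR3A00 mem_atlas
  haveI := isGloballyMinimal_of_mem_atlasR3A00 mem_atlas
  haveI iNZ : NeZero ((c11642a1.e.baseChange ℚ).conductorNorm ℤ) := neZero_conductorNorm_of_isElliptic _
  haveI i5 := Fact.mk (by norm_num : Nat.Prime 5)
  have h := exactRowDepth_5_neg7_iff_twistSelmer hSW h372 h84 K hK hD
  rw [mordellWeilRank_eq_three] at h
  refine Iff.trans ?_ (h.trans (by norm_num))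
  constructor
  · rintro ⟨Dt, β, ι, n₁, d, hsq, hk, hν, hne⟩
    exact ⟨Dt, β, ι, n₁, d, hsq, hk, by omega, hne⟩
  · rintro ⟨Dt, β, ι, n₁, d, hsq, hk, hν, hne⟩
    exact ⟨Dt, β, ι, n₁, d, hsq, hk, by omega, hne⟩

/-- **EXACT READING OF THE CRUX AT `11642a1`, `(5, −7)`, rank discharged.** For ANY imaginary quadratic `K` with `d_K = −7`:
the `∃`-body of `KolyvaginDepthSupplyKN` at `(E, 5, K)` `↔` «`#Sel_5(E^{(−7)}/ℚ) ≤ 125` ∨ (`Ш(E^{(−7)}/ℚ)[5] = 0` ∧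
`rank E^{(−7)}(ℚ) = 4`)» (from `exactBody_5_neg7_iff_twistCondition` with `rank E = 3`). The second disjunct is the
second sign (a rank-FOUR twist of conductor `570 458`); at the rank-zero twist only the first can hold. CONDITIONAL on (γ),
W. Zhang L8.4 (1) / 9.1 and SW Thm. 1.1 by name; per curve; BSD is not proved by it. [cite: SteinWuthrich2013, Thm. 1.1 (p. 1758)]
[cite: WZhang2014, Lemma 8.4 (1) (p. 236), Thm. 9.1 (p. 240)] [cite: GrossLMS1991, Prop. 3.7 (2)] -/
theorem exactBody_5_neg7_iff_twistCondition_rankThree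
    (hSW : SteinWuthrich2013_sha_inf_torsionBy_eq_bot_of_two_le_rank)
    (h372 : GrossLMS1991.prop37_2_frobeniusCongruence)
    (h84 : Literature.NumberTheory.EllipticCurves.WZhang2014_lemma84_exists_minimal_kolyvaginClass_one_selmerCard)
    (K : Type) [Field K] [NumberField K] (hK : IsImaginaryQuadratic K)
    (hD : NumberField.discr K = -7) :
    haveI := isElliptic_of_mem_atlasR3A00 mem_atlas;
    haveI := isGloballyMinimal_of_mem_atlasR3A00 mem_atlas;
    haveI : NeZero ((c11642a1.e.baseChange ℚ).conductorNorm ℤ) := neZero_conductorNorm_of_isElliptic _;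
    haveI := Fact.mk (by norm_num : Nat.Prime 5);
    (∃ (Dt : ModularParametrizationData (c11642a1.e.baseChange ℚ) ((c11642a1.e.baseChange ℚ).conductorNorm ℤ)) (β : ℤ) (ι : K →+* ℂ) (n₁ : ℕ)
      (d : KolyvaginHeegnerData Dt β ι n₁), Squarefree n₁ ∧
        (∀ q ∈ n₁.primeFactors, Zhang2014.IsKolyvaginPrime ((c11642a1.e.baseChange ℚ).conductorNorm ℤ) (c11642a1.e.baseChange ℚ) K 5 q) ∧
        d.kolyvaginClass (p := 5) (by norm_num) 1 ≠ 0 ∧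
        (n₁.primeFactors.card + 1 ≤ (c11642a1.e.baseChange ℚ).mordellWeilRank ∨
          (n₁.primeFactors.card ≤ (c11642a1.e.baseChange ℚ).mordellWeilRank ∧
            n₁.primeFactors.card + 1 ≤ ((c11642a1.e.baseChange ℚ).quadraticTwist (NumberField.discr K : ℚ)).mordellWeilRank))) ↔
    (Nat.card (((c11642a1.e.baseChange ℚ).quadraticTwist (NumberField.discr K : ℚ)).selmerGroup (5 : ℕ)) ≤ 125 ∨
      ((((c11642a1.e.baseChange ℚ).quadraticTwist (NumberField.discr K : ℚ)).sha ⊓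
          AddSubgroup.torsionBy ((c11642a1.e.baseChange ℚ).quadraticTwist (NumberField.discr K : ℚ)).galH1 ((5 : ℕ) : ℤ) :
          AddSubgroup ((c11642a1.e.baseChange ℚ).quadraticTwist (NumberField.discr K : ℚ)).galH1) = ⊥ ∧
        ((c11642a1.e.baseChange ℚ).quadraticTwist (NumberField.discr K : ℚ)).mordellWeilRank = 4)) := by
  haveI := isElliptic_of_mem_atlasR3A00 mem_atlas
  haveI := isGloballyMinimal_of_mem_atlasR3A00 mem_atlas
  haveI iNZ : NeZero ((c11642a1.e.baseChange ℚ).conductorNorm ℤ) := neZero_conductorNorm_of_isElliptic _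
  haveI i5 := Fact.mk (by norm_num : Nat.Prime 5)
  refine (exactBody_5_neg7_iff_twistCondition hSW h372 h84 K hK hD).trans ?_
  rw [mordellWeilRank_eq_three]
  norm_num

/-- **THE INSTRUMENT'S PREDICTION AT `11642a1` FROM ONE `L`-VALUE (Skinner 2016 Thm. C + GZK + (γ) + W. Zhang + SW by name).**
IF the rank-zero twist `T = E^{(−7)}` (minimal model `[1,5,0,−784,−9604]`) has `L(T,1) ≠ 0` (numerically `≈ 7.22`) and
`ord_5(L(T,1)/Ω_T) ≤ 0`, THEN for ANY imaginary quadratic `K` with `d_K = −7` there ARE a frame, a square-free product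
`n₁ = ℓ₁ℓ₂` of EXACTLY TWO Kolyvagin primes and a Kolyvagin–Heegner datum of conductor `n₁` whose level-one class
`c_1(ℓ₁ℓ₂) ≢ 0 (mod 5)` — a falsifiable prediction for a depth-2 Jetchev–Lauter–Stein computation, obtained with NO
Kolyvagin-class computation (`exactRowDepthTwo_5_neg7_iff_twistSelmer` ← `#Sel_5(E^{(−7)}) = 1 ≤ 25`,
`…RankThree11642a1TwistLValue`). CONDITIONAL on the five named facts and the two `L`-value hypotheses; per curve; BSD is
not proved by it. [cite: Skinner2016PacificMC, Thm. C (p. 173)] [cite: WZhang2014, Lemma 8.4 (1) (p. 236)]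
[cite: GrossLMS1991, Prop. 3.7 (2)] [cite: JetchevLauterStein2009, §3.6 (arXiv:0707.0032)] -/
theorem exists_kolyvaginClass_depthTwo_ne_zero_of_LValue
    (hSW : SteinWuthrich2013_sha_inf_torsionBy_eq_bot_of_two_le_rank)
    (h372 : GrossLMS1991.prop37_2_frobeniusCongruence)
    (h84 : Literature.NumberTheory.EllipticCurves.WZhang2014_lemma84_exists_minimal_kolyvaginClass_one_selmerCard)
    (hSk : Skinner2016_padicValRat_bsd_rank_zero) (hGZK : rank_eq_analyticRank_of_analyticRank_le_one)
    (K : Type) [Field K] [NumberField K] (hK : IsImaginaryQuadratic K) (hD : NumberField.discr K = -7)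
    (hL : haveI := isElliptic_twist7;
      ((⟨1, 5, 0, -784, -9604⟩ : WeierstrassCurve ℤ).map (Int.castRingHom ℚ)).entireLFunction 1 ≠ 0)
    (hval : haveI := isElliptic_twist7; haveI := isGloballyMinimal_twist7;
      ∀ q : ℚ, ((⟨1, 5, 0, -784, -9604⟩ : WeierstrassCurve ℤ).map (Int.castRingHom ℚ)).entireLFunction 1 /
          ((((⟨1, 5, 0, -784, -9604⟩ : WeierstrassCurve ℤ).map (Int.castRingHom ℚ)).realPeriodRat : ℝ) : ℂ) = (q : ℂ) →
        padicValRat 5 q ≤ 0) :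
    haveI := isElliptic_of_mem_atlasR3A00 mem_atlas;
    haveI := isGloballyMinimal_of_mem_atlasR3A00 mem_atlas;
    haveI : NeZero ((c11642a1.e.baseChange ℚ).conductorNorm ℤ) := neZero_conductorNorm_of_isElliptic _;
    haveI := Fact.mk (by norm_num : Nat.Prime 5);
    ∃ (Dt : ModularParametrizationData (c11642a1.e.baseChange ℚ) ((c11642a1.e.baseChange ℚ).conductorNorm ℤ)) (β : ℤ) (ι : K →+* ℂ) (n₁ : ℕ)
      (d : KolyvaginHeegnerData Dt β ι n₁), Squarefree n₁ ∧
        (∀ q ∈ n₁.primeFactors, Zhang2014.IsKolyvaginPrime ((c11642a1.e.baseChange ℚ).conductorNorm ℤ) (c11642a1.e.baseChange ℚ) K 5 q) ∧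
        n₁.primeFactors.card = 2 ∧ d.kolyvaginClass (p := 5) (by norm_num) 1 ≠ 0 := by
  haveI := isElliptic_of_mem_atlasR3A00 mem_atlas
  haveI := isGloballyMinimal_of_mem_atlasR3A00 mem_atlas
  haveI iNZ : NeZero ((c11642a1.e.baseChange ℚ).conductorNorm ℤ) := neZero_conductorNorm_of_isElliptic _
  haveI i5 := Fact.mk (by norm_num : Nat.Prime 5)
  have h1 := natCard_selmerGroup_quadraticTwist_neg7_eq_one_of_LValue hSk hGZK hL hval
  refine (exactRowDepthTwo_5_neg7_iff_twistSelmer hSW h372 h84 K hK hD).mpr ?_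
  have hcast : (NumberField.discr K : ℚ) = (-7 : ℚ) := by rw [hD]; norm_num
  rw [hcast, h1]
  norm_num

end C11642a1

end Summit.BirchSwinnertonDyer.BirchSwinnertonDyer.Theorems.KolyvaginDepthDoor

end
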